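import Literature.MathematicalPhysics.QuantumFieldTheory.Balaban1983to89.Node00.DatumAvLayer
import Summits.QuantumFields.BalabanUV.T4Continuum.Spine.NE7.QLaBlockAvgTwoLevelContraction
import Summits.QuantumFields.BalabanUV.T4Continuum.Spine.NE7.QLaConeLocality
import Literature.MathematicalPhysics.QuantumFieldTheory.Balaban1983to89.T4Spectator

/-!
# Spine/NE7/NodeSAtDatumOfRecord — NODE S's averaging-side chain AT NODE 00's DATUM OF RECORD (Stage 0):
# `IsDatumOfRecord₀ F N D` ⟹ `HolDevBound (D.av K) dom e θ`, `LoopDefectBound (D.av K) dom (e²∕2) θ` and the CONE-LOCAL defect bound,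
# at every cutoff `K` — the first by-name meeting of this seat's files 8 ∕ 25–33 ∕ 40 with the object node's own predicate

Cell `pub-balaban-gaps` (YM blitz Y1, track G2, seat `ne7`, generation 13); text of record `run/shared/lean/pub/pub-balaban-gaps/ne/NE7.md`
(census §8 0quaterdecies (ii): «NE7-own typing resumes against the YM-DAG NODE 00 objects»).  47th `Spine/NE7/` file; 0 `def`, 0 sorry;
[bookkeeping] compositions BY NAME.

WHY.  NODE 00's Stage-0∕1 modules landed on 2026-08-24 (seat `pub-ymgap-node00-def` g24, `Node00/DatumAvLayer.lean` p386661 ✓): the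
averaging operations of record `Node00.avOfRecord F N K j = blockAvg expMeanLogSU` ([Balaban1987RG1] (0.3)–(0.4) on `SU(N)`), the STAGED
datum predicate `Node00.IsDatumOfRecord₀ F N D := D.av = avOfRecord F N`, and binder B1 at every such datum
(`Node00.isPrintedAveraged₁_of_av`, `isPrintedAveraged_of_isDatumOfRecord₀`).  This seat's NODE S chain was proved for exactly that
averaging (files 25–29: `holDevBound_blockAvgSU`, `loopDefectBound_blockAvgSU`, `holDevBound_of_isPrintedAveraged₁`; files 30–33 the
two-level disjunct and the headline's common domain `domPrinted`; file 40 the cone-local defect bound).  This file composes the two BY NAME: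
§1 at every datum of record (Stage 0) and every cutoff `K`, `HolDevBound (D.av K) (dom (F.P K) (Fin N)) e θ` and
`LoopDefectBound (D.av K) (dom …) (e²∕2) θ`, `θ = L^{1−d}` (`theta`) — on the ONE-LEVEL sup-ball family `dom` (larger than the headline's
`domPrinted = dom ∩ dom₂`), plus the `domPrinted` forms for consumers typed against file 33 ∕ 43; §2 the same for the bare averaging of
record `avOfRecord F N K` (no datum); §3 the CONE-LOCAL DEFECT BOUND at the datum of record (file 40's `loopDefect_le_of_cone_support` with
`1 ∈ dom` and the truncation binder discharged here: `truncate_mem_dom`) — for every downward-closed bond-set cone containing the loop,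
`1 − W(iterFrom (D.av K) k n V)(walk x w) ≤ ½e²·(|w|·|Λ ∩ cone base|·Dm)²·(θ²)ⁿ`; §4 WHERE `t` DOES NOT ENTER at the object node's
transport of record: the rider is a SPECTATOR of `Node00.TrhoOfRecord` (node O2's `T4Spectator.isRT_mul_comp` at `Node00.isRT_TrhoOfRecord`):
`T(ρ·(g∘avg)) = (Tρ)·g` weakly for every bounded measurable unit-scale factor `g` — so along the R-free layer of record `t` reaches no
step constant (census §4bis; the `t`-dependence is the large-field operation's, NODE 00 Stage 5).  §5: a density tower generated by `TrhoOfRecord` alone from an integrable start is an `IsRTChain` along `avOfRecord`, hence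
`t`-BLIND END TO END (`integral_tower_mul_eq_integral_zero_comp_iter`: `∫ ρ_{Kc}·f = ∫ ρ₀·(f ∘ Ū^{Kc})`, normalisation carried,
`integral_tower_eq_integral_zero`).  The closed-form neighbourhood of file 41 ∕ 43 (`loopDefect_le_of_near_support_printed`) transfers
like §3 once those modules are importable (one line; successor).

HONEST FRAMING.  The Stage-0 predicate constrains ONLY the datum's averaging maps (`D.av`); the construction `D.C`, the β-input, Bałaban's
large-field operation `R` and the (2.18) [III] densities are NOT constrained or constructed (NODE 00 Stage 5).  So this is NODE S's
AVERAGING-SIDE input at the object node's datum predicate, nothing more: the per-entry W-fmt data (ν₁, ν₂, rider, support statement on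
print-kind domains — census (α)–(γ)) remain the object node's.  [bookkeeping]; nothing of Bałaban's asserted beyond print; NE7 NOT proved;
spine 0∕9; one fixed finite T⁴ — NOT ℝ⁴, NOT infinite volume, NOT a mass gap, NOT Clay.  No classification word moves (R10).
-/

noncomputable section

open MeasureTheory

namespace Summit.QuantumFields.BalabanUV.T4Continuum.Spine.NE7

open Literature.MathematicalPhysics.QuantumFieldTheory.Balaban1983to89
open Literature.MathematicalPhysics.QuantumFieldTheory.Balaban1983to89.T4Continuum
open Literature.MathematicalPhysics.QuantumFieldTheory.Balaban1983to89.T4Continuum.FiniteEpsData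
open Literature.MathematicalPhysics.QuantumFieldTheory.Balaban1983to89.T4AvgSensitivity
open Literature.MathematicalPhysics.QuantumFieldTheory.Balaban1983to89.T4AvgDerivBound
open Literature.MathematicalPhysics.QuantumFieldTheory.Balaban1983to89.BlockAveraging (blockAvg)
open Literature.MathematicalPhysics.QuantumFieldTheory.Balaban1983to89.ExpMeanLog (expMeanLogSU)
open Literature.MathematicalPhysics.QuantumFieldTheory.Balaban1983to89.Node00
  (avOfRecord IsDatumOfRecord₀ isPrintedAveraged₁_of_av isPrintedAveraged_of_isDatumOfRecord₀)

variable {F : T4Family} {N : ℕ} [NeZero N]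

/-! ## §1 At every datum of record (Stage 0) -/

/-- **NODE S's HOLONOMY-LEVEL INPUT AT THE DATUM OF RECORD**: for every finite-`ε` datum `D` over `SU(N)` with `IsDatumOfRecord₀ F N D`
(its averaging maps ARE Bałaban's (0.3)–(0.4) of record) and every cutoff `K`, `HolDevBound (D.av K) dom e θ` on the one-level sup-ball
family — file 29's `holDevBound_of_isPrintedAveraged₁` at NODE 00's `isPrintedAveraged₁_of_av`. [bookkeeping] -/
theorem holDevBound_of_isDatumOfRecord₀ (D : FiniteEpsData F (Matrix.specialUnitaryGroup (Fin N) ℂ))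
    (hD : IsDatumOfRecord₀ F N D) (K : ℕ) :
    HolDevBound (D.av K) (dom (F.P K) (Fin N)) (Real.exp 1) (theta (F.P K)) :=
  holDevBound_of_isPrintedAveraged₁ D (isPrintedAveraged₁_of_av F N D hD) K

/-- … and the second-order LOOP-DEFECT bound (constant `e²∕2`, criticality on `SU(N)`) at the datum of record. [bookkeeping] -/
theorem loopDefectBound_of_isDatumOfRecord₀ (D : FiniteEpsData F (Matrix.specialUnitaryGroup (Fin N) ℂ))
    (hD : IsDatumOfRecord₀ F N D) (K : ℕ) :
    LoopDefectBound (D.av K) (dom (F.P K) (Fin N)) (1 / 2 * Real.exp 1 ^ 2) (theta (F.P K)) :=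
  loopDefectBound_of_isPrintedAveraged₁ D (isPrintedAveraged₁_of_av F N D hD) K

/-- The headline-class form (common domain `domPrinted = dom ∩ dom₂` of file 33, the hypothesis shape of file 43's
`loopDefect_le_of_near_support_printed`) at the datum of record. [bookkeeping] -/
theorem holDevBound_domPrinted_of_isDatumOfRecord₀ (D : FiniteEpsData F (Matrix.specialUnitaryGroup (Fin N) ℂ))
    (hD : IsDatumOfRecord₀ F N D) (K : ℕ) :
    HolDevBound (D.av K) (domPrinted (F.P K) (Fin N)) (Real.exp 1) (theta (F.P K)) :=
  holDevBound_of_isPrintedAveraged D (isPrintedAveraged_of_isDatumOfRecord₀ F N D hD) K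

/-- … and `LoopDefectBound` on `domPrinted` at the datum of record. [bookkeeping] -/
theorem loopDefectBound_domPrinted_of_isDatumOfRecord₀ (D : FiniteEpsData F (Matrix.specialUnitaryGroup (Fin N) ℂ))
    (hD : IsDatumOfRecord₀ F N D) (K : ℕ) :
    LoopDefectBound (D.av K) (domPrinted (F.P K) (Fin N)) (1 / 2 * Real.exp 1 ^ 2) (theta (F.P K)) :=
  loopDefectBound_of_isPrintedAveraged D (isPrintedAveraged_of_isDatumOfRecord₀ F N D hD) K

/-! ## §2 For the bare averaging operations of record -/

/-- `HolDevBound` for NODE 00's averaging operations of record themselves, on every torus `F.P K` (file 29's `holDevBound_blockAvgSU`;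
`avOfRecord F N K = fun j => blockAvg expMeanLogSU` definitionally). [bookkeeping] -/
theorem holDevBound_avOfRecord (K : ℕ) :
    HolDevBound (avOfRecord F N K) (dom (F.P K) (Fin N)) (Real.exp 1) (theta (F.P K)) :=
  holDevBound_blockAvgSU

/-- `LoopDefectBound` for the averaging operations of record (file 29's `loopDefectBound_blockAvgSU`). [bookkeeping] -/
theorem loopDefectBound_avOfRecord (K : ℕ) :
    LoopDefectBound (avOfRecord F N K) (dom (F.P K) (Fin N)) (1 / 2 * Real.exp 1 ^ 2) (theta (F.P K)) :=
  loopDefectBound_blockAvgSU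

/-! ## §3 The cone-local defect bound at the datum of record -/

open Classical in
/-- A configuration of the one-level sup-ball domain `dom`, truncated to any bond set (`V` on `S`, `1` off `S`), stays in `dom`. [folklore] -/
theorem truncate_mem_dom {P : Params} {j : ℕ} {V : GaugeField P j (Matrix.specialUnitaryGroup (Fin N) ℂ)}
    (hV : V ∈ dom P (Fin N) j) (S : Finset (PBond P j)) :
    (fun b => if b ∈ S then V b else 1) ∈ dom P (Fin N) j := by
  intro b
  show dist1 (if b ∈ S then V b else 1) ≤ rad P (Fin N) j
  by_cases hb : b ∈ S
  · rw [if_pos hb]; exact hV b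
  · rw [if_neg hb]; exact one_mem_dom (n := Fin N) j b

open Classical in
/-- **NODE S's CONE-LOCAL DEFECT BOUND AT THE DATUM OF RECORD.**  For every datum of record `D` (Stage 0), cutoff `K`, levels
`k + n ≤ m + K`, every family of bond sets `Dc i ⊆ bonds(T^{(k+i)})` closed downwards under one-step dependence (`hclosed`: a level-`(k+i)`
bond whose block is an endpoint of a cone bond of level `k+i+1` is in the cone) whose top contains the closed walk `(x, w)`, and every
level-`k` configuration `V ∈ dom` trivial off a finite bond set `Λ` with one-bond deviations `≤ Dm`:
`1 − W(iterFrom (D.av K) k n V)(walk x w) ≤ ½e²·(|w|·|ΛD|·Dm)²·(θ²)ⁿ` with `ΛD = Λ ∩ Dc 0` — only the base of the cone is charged.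
File 40's `loopDefect_le_of_cone_support` at `loopDefectBound_of_isDatumOfRecord₀`; `1 ∈ dom` and the truncation binder discharged.
[bookkeeping] -/
theorem loopDefect_le_of_cone_support_of_isDatumOfRecord₀ (D : FiniteEpsData F (Matrix.specialUnitaryGroup (Fin N) ℂ))
    (hD : IsDatumOfRecord₀ F N D) (K : ℕ) {k n : ℕ} (hn : k + n ≤ (F.P K).m + (F.P K).K)
    (Dc : (i : ℕ) → Set (PBond (F.P K) (k + i)))
    (hclosed : ∀ i, ∀ c ∈ Dc (i + 1), ∀ b : PBond (F.P K) (k + i),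
      (blockOf b.src = c.src ∨ blockOf b.src = c.tgt) → b ∈ Dc i)
    (x : Site (F.P K) (k + n)) (w : List (Letter (F.P K).d)) (hw : walkEnd x w = x) (hwalk : ∀ s ∈ walk x w, s.bond ∈ Dc n)
    (V : GaugeField (F.P K) k (Matrix.specialUnitaryGroup (Fin N) ℂ)) (hV : V ∈ dom (F.P K) (Fin N) k)
    (Λ ΛD : Finset (PBond (F.P K) k)) (hΛD : ∀ b, b ∈ ΛD ↔ b ∈ Λ ∧ b ∈ Dc 0) (hoff : ∀ b, b ∉ Λ → V b = 1)
    {Dm : ℝ} (hDm : ∀ b ∈ Λ, dist1 (V b) ≤ Dm) :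
    1 - loopAt (iterFrom (D.av K) k n V) (walk x w)
      ≤ 1 / 2 * Real.exp 1 ^ 2 * ((w.length : ℝ) * ΛD.card * Dm) ^ 2 * (theta (F.P K) ^ 2) ^ n :=
  loopDefect_le_of_cone_support (loopDefectBound_of_isDatumOfRecord₀ D hD K) (by positivity) (theta_pos (F.P K)).le hn Dc
    hclosed x w hw hwalk V (one_mem_dom (n := Fin N) k) Λ ΛD hΛD hoff hDm (truncate_mem_dom hV ΛD)

/-! ## §4 Where `t` does NOT enter: the rider is a spectator of the transport of record -/

section Spectator

open Literature.MathematicalPhysics.QuantumFieldTheory.Balaban1983to89.Node00 (TrhoOfRecord isRT_TrhoOfRecord)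
open Literature.MathematicalPhysics.QuantumFieldTheory.Balaban1983to89.T4Spectator (isRT_mul_comp)

/-- **THE RIDER IS A SPECTATOR OF NODE 00's TRANSPORT OF RECORD** (node O2 at the object node): for every integrable level-`k` density `ρ`
(`k < K`) and every bounded measurable factor `g` of the NEXT level's field (e.g. `g = e^{t·F∘avg^{K−k−1}}`, the unit-scale rider pulled
back to level `k+1`), `(TrhoOfRecord ρ)·g` is the renormalisation transform of `ρ·(g ∘ avg)` along the averaging of record — the rider
passes through [Balaban1985Averaging] (10) unchanged; `t` reaches no constant of a pure `T` step. `T4Spectator.isRT_mul_comp` at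
`Node00.isRT_TrhoOfRecord`. [bookkeeping] -/
theorem rider_isRT_TrhoOfRecord (K k : ℕ) (hk : k < K) (ρ : Density (F.P K) k (Matrix.specialUnitaryGroup (Fin N) ℂ))
    (hρ : Integrable ρ (fieldMeasure (F.P K) k (Matrix.specialUnitaryGroup (Fin N) ℂ)))
    {g : GaugeField (F.P K) (k + 1) (Matrix.specialUnitaryGroup (Fin N) ℂ) → ℝ} (hg : Measurable g)
    (hgb : ∃ C : ℝ, ∀ V, |g V| ≤ C) :
    IsRT (avOfRecord F N K k).avg (fun U => ρ U * g ((avOfRecord F N K k).avg U))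
      (fun V => TrhoOfRecord F N K k ρ V * g V) :=
  isRT_mul_comp (isRT_TrhoOfRecord F N K k hk ρ hρ) hg hgb

/-- The integrated form: `∫ (Tρ)(V)·g(V) dV = ∫ ρ(U)·g(Ū) dU` for the transport of record and every bounded measurable `g` — the
push-forward identity `Setup.IsRT` BY NAME at `Node00.isRT_TrhoOfRecord` (the dressed partition function after a pure `T` step is the
Wilson-side integral of the pulled-back rider). [bookkeeping] -/
theorem integral_TrhoOfRecord_mul (K k : ℕ) (hk : k < K) (ρ : Density (F.P K) k (Matrix.specialUnitaryGroup (Fin N) ℂ))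
    (hρ : Integrable ρ (fieldMeasure (F.P K) k (Matrix.specialUnitaryGroup (Fin N) ℂ)))
    (g : GaugeField (F.P K) (k + 1) (Matrix.specialUnitaryGroup (Fin N) ℂ) → ℝ) (hg : Measurable g)
    (hgb : ∃ C : ℝ, ∀ V, |g V| ≤ C) :
    ∫ V, TrhoOfRecord F N K k ρ V * g V ∂fieldMeasure (F.P K) (k + 1) (Matrix.specialUnitaryGroup (Fin N) ℂ)
      = ∫ U, ρ U * g ((avOfRecord F N K k).avg U) ∂fieldMeasure (F.P K) k (Matrix.specialUnitaryGroup (Fin N) ℂ) :=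
  isRT_TrhoOfRecord F N K k hk ρ hρ g hg hgb

end Spectator

/-! ## §5 The R-free tower of record is `t`-blind end to end -/

section Tower

open Literature.MathematicalPhysics.QuantumFieldTheory.Balaban1983to89.Node00
  (TrhoOfRecord isRT_TrhoOfRecord integrable_TrhoOfRecord avOfRecord_measurable)
open Literature.MathematicalPhysics.QuantumFieldTheory.Balaban1983to89.T4Spectator
  (IsRTChain integral_mul_eq_integral_mul_comp_iter integral_eq_integral_zero)

/-- A density tower generated by NODE 00's transport of record from an integrable start — `ρ (k+1) = TrhoOfRecord (ρ k)` for
`k < Kc ≤ K` — is integrable at every level `k ≤ Kc` and IS a chain of renormalisation transforms along the averaging of record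
(`T4Spectator.IsRTChain`), by `Node00.integrable_TrhoOfRecord` ∕ `isRT_TrhoOfRecord` step by step. [bookkeeping] -/
theorem isRTChain_of_TrhoOfRecord_tower (K Kc : ℕ) (hKc : Kc ≤ K)
    (ρ : (k : ℕ) → Density (F.P K) k (Matrix.specialUnitaryGroup (Fin N) ℂ))
    (h0 : Integrable (ρ 0) (fieldMeasure (F.P K) 0 (Matrix.specialUnitaryGroup (Fin N) ℂ)))
    (htower : ∀ k, k < Kc → ρ (k + 1) = TrhoOfRecord F N K k (ρ k)) :
    (∀ k, k ≤ Kc → Integrable (ρ k) (fieldMeasure (F.P K) k (Matrix.specialUnitaryGroup (Fin N) ℂ))) ∧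
      IsRTChain (avOfRecord F N K) ρ Kc := by
  have hint : ∀ k, k ≤ Kc → Integrable (ρ k) (fieldMeasure (F.P K) k (Matrix.specialUnitaryGroup (Fin N) ℂ)) := by
    intro k
    induction k with
    | zero => exact fun _ => h0
    | succ k ih =>
        intro hk
        have hk' : k < Kc := Nat.lt_of_succ_le hk
        rw [htower k hk']
        exact integrable_TrhoOfRecord F N K k (lt_of_lt_of_le hk' hKc) (ρ k) (ih hk'.le)
  refine ⟨hint, fun k hk => ?_⟩
  rw [htower k hk]
  exact isRT_TrhoOfRecord F N K k (lt_of_lt_of_le hk hKc) (ρ k) (hint k hk.le)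

/-- **THE R-FREE TOWER OF RECORD IS `t`-BLIND END TO END** (node O2's spectator identity `T4Spectator.integral_mul_eq_integral_mul_comp_iter`
at NODE 00's objects): for such a tower and every bounded measurable function `f` of the level-`Kc` field — e.g. the rider `e^{t·F}` of a
unit-scale observable when `Kc = K` — `∫ ρ_{Kc}(V)·f(V) dV = ∫ ρ₀(U)·f(Ū^{Kc}) dU`: the dressed partition function of a run made of
NODE 00's transport ALONE is the start density's integral of the PULLED-BACK rider; no step constant depends on `t`.  The `t`-dependence
NE7 is about enters only with Bałaban's large-field operation `R` (NODE 00 Stage 5; census §4bis, R8 ∕ R23). [bookkeeping] -/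
theorem integral_tower_mul_eq_integral_zero_comp_iter (K Kc : ℕ) (hKc : Kc ≤ K)
    (ρ : (k : ℕ) → Density (F.P K) k (Matrix.specialUnitaryGroup (Fin N) ℂ))
    (h0 : Integrable (ρ 0) (fieldMeasure (F.P K) 0 (Matrix.specialUnitaryGroup (Fin N) ℂ)))
    (htower : ∀ k, k < Kc → ρ (k + 1) = TrhoOfRecord F N K k (ρ k))
    (f : GaugeField (F.P K) Kc (Matrix.specialUnitaryGroup (Fin N) ℂ) → ℝ) (hf : Measurable f) (hfb : ∃ C : ℝ, ∀ V, |f V| ≤ C) :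
    ∫ V, ρ Kc V * f V ∂fieldMeasure (F.P K) Kc (Matrix.specialUnitaryGroup (Fin N) ℂ)
      = ∫ U, ρ 0 U * f (Averaging.iter (avOfRecord F N K) Kc U) ∂fieldMeasure (F.P K) 0 (Matrix.specialUnitaryGroup (Fin N) ℂ) :=
  integral_mul_eq_integral_mul_comp_iter (avOfRecord F N K) (avOfRecord_measurable F N K) ρ Kc
    (isRTChain_of_TrhoOfRecord_tower K Kc hKc ρ h0 htower).2 f hf hfb

/-- … in particular the NORMALISATION is carried unchanged: `∫ ρ_{Kc} = ∫ ρ₀` ([Balaban1985UV3] (6) by name,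
`T4Spectator.integral_eq_integral_zero`). [bookkeeping] -/
theorem integral_tower_eq_integral_zero (K Kc : ℕ) (hKc : Kc ≤ K)
    (ρ : (k : ℕ) → Density (F.P K) k (Matrix.specialUnitaryGroup (Fin N) ℂ))
    (h0 : Integrable (ρ 0) (fieldMeasure (F.P K) 0 (Matrix.specialUnitaryGroup (Fin N) ℂ)))
    (htower : ∀ k, k < Kc → ρ (k + 1) = TrhoOfRecord F N K k (ρ k)) :
    ∫ V, ρ Kc V ∂fieldMeasure (F.P K) Kc (Matrix.specialUnitaryGroup (Fin N) ℂ)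
      = ∫ U, ρ 0 U ∂fieldMeasure (F.P K) 0 (Matrix.specialUnitaryGroup (Fin N) ℂ) :=
  integral_eq_integral_zero (avOfRecord F N K) ρ Kc (isRTChain_of_TrhoOfRecord_tower K Kc hKc ρ h0 htower).2

end Tower

end Summit.QuantumFields.BalabanUV.T4Continuum.Spine.NE7

end
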